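import Mathlib
import HarnessLib
import Summits.Ventures.LatticeQCDFlow.Scaling.CharFunTaylorBound
import Summits.Ventures.LatticeQCDFlow.Scaling.LossCouplingInversion
import Summits.Ventures.LatticeQCDFlow.Scaling.LossDiagonalRate

/-!
# LatticeQCDFlow / Scaling — the FORWARD training loss: rates `|cgf′(t) − tσ²| ≤ 2t²K³`,
# `|t·cgf′(t) − cgf(t) − t²σ²/2| ≤ 4|t|³K³`, and INVERSION `n·fwd(β_n) → D ⇒ β_n√n → √(2D/σ²)`

HONEST FRAMING: exact (Metropolis-corrected) sampling algorithms for lattice gauge theory;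
figures of merit are autocorrelation/cost numbers at stated couplings and volumes; no
continuum-physics claim.

Venture `LatticeQCDFlow` (cell pub-lqcd), topic `Scaling`; FANOUT row 3 (`s0-u1-a`, S0-B
implementation A, GEN-20).  NEW WORK of the cell (elementary), on row 3's `Scaling/CharFunTaylorBound`
(`|M(u) − 1 − u²σ²/2| ≤ |u|³K³`), `Scaling/LossCouplingInversion` (`cgf ≥ 0`), `Scaling/CumulantDiagonalLimit`
(every exponential moment of a bounded statistic exists) and Mathlib's `deriv_mgf`, `deriv_cgf`,
`iteratedDeriv_two_cgf_eq_integral`, `monotoneOn_of_deriv_nonneg`; NO definition is introduced; nothing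
is cited.  The FORWARD loss of the untrained `n`-block sampler is `n·(β·cgf′(β) − cgf(β))`
(`Scaling/TiltKLDivergence.toReal_klDiv_pi_tilted_left`); flows trained on the forward
(mode-covering) divergence report this quantity, so the dictionary needs its inversion too.

## Content (all `[ours]`), `h` measurable, `|h| ≤ K`, `∫ h dν = 0`, `σ² = Var h`

* `abs_deriv_mgf_sub_le` — `|M′(t) − tσ²| ≤ t²K³` (`|t|K ≤ 1`); `one_le_mgf`; **`abs_deriv_cgf_sub_le`** —
  `|cgf′(t) − tσ²| ≤ 2t²K³` (`|t|K ≤ 1/2`); **`abs_fwdBregman_sub_le`** —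
  `|t·cgf′(t) − cgf(t) − t²σ²/2| ≤ 4|t|³K³`: the forward loss is quadratic in the coupling with an
  explicit cubic error, uniformly in the volume (`abs_nat_mul_fwdBregman_sub_le`);
* `deriv_fwdBregman`, `fwdBregman_monotoneOn`, `fwdBregman_nonneg` — `t ↦ t·cgf′(t) − cgf(t)` has
  derivative `t·cgf″(t) ≥ 0`, is non-decreasing on `[0, ∞)` and non-negative there;
* **`tendsto_zero_of_nat_mul_fwdBregman_tendsto`**, **`sqrt_mul_tendsto_of_nat_mul_fwdBregman_tendsto`**
  — INVERSION OF THE FORWARD LOSS: `β_n ≥ 0`, `σ² ≠ 0`, `n·(β_n cgf′(β_n) − cgf(β_n)) → D` ⇒ `β_n → 0` and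
  `β_n√n → √(2D/σ²)` — the same diagonal constant as for the reverse loss
  (`Scaling/LossCouplingInversion`), so the sequels' conversions (`acc → erfc(√(D/2))`,
  `ESS → e^{−2D}`) hold verbatim with the forward loss in place of the reverse loss.

NOT CLAIMED: negative couplings; unbounded statistics; any value at the cell's `(β, L)`; nothing
re-scored.
-/

noncomputable section

namespace Summit.Ventures.LatticeQCDFlow.Theory2

open MeasureTheory ProbabilityTheory Filter Finset Real Set
open scoped Topology NNReal

section ForwardRate

variable {X : Type*} {mX : MeasurableSpace X} {ν : Measure X} [IsProbabilityMeasure ν] {g : X → ℝ}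

/-- **`|M′(t) − tσ²| ≤ t²K³`** for `|t|K ≤ 1` (bounded centred statistic; `M′(t) = E[h e^{th}]`,
pointwise `|x e^{tx} − x − tx²| ≤ |x|(tx)²`). [ours] -/
theorem abs_deriv_mgf_sub_le (hgm : Measurable g) {K : ℝ} (hK : ∀ x, |g x| ≤ K)
    (h0 : ∫ x, g x ∂ν = 0) {t : ℝ} (ht : |t| * K ≤ 1) :
    |deriv (mgf g ν) t - t * Var[g; ν]| ≤ t ^ 2 * K ^ 3 := by
  have hgb : ∀ᵐ x ∂ν, g x ∈ Set.Icc (-K) K := ae_of_all _ fun x => abs_le.1 (hK x)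
  have hga : AEMeasurable g ν := hgm.aemeasurable
  have hint : interior (integrableExpSet g ν) = Set.univ :=
    interior_integrableExpSet_eq_univ_of_mem_Icc hga hgb
  have hmem : t ∈ interior (integrableExpSet g ν) := by rw [hint]; exact Set.mem_univ _
  rw [deriv_mgf hmem]
  have hgi : Integrable g ν := Integrable.of_mem_Icc (-K) K hga hgb
  have hg2 : Integrable (fun x => g x ^ 2) ν := (memLp_of_bounded hgb hga.aestronglyMeasurable 2).integrable_sq
  have hvar : Var[g; ν] = ∫ x, g x ^ 2 ∂ν := by
    rw [variance_eq_integral hga, h0]; simp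
  have hprod : Integrable (fun x => g x * Real.exp (t * g x)) ν := by
    refine Integrable.of_bound (hgm.mul (Real.measurable_exp.comp (measurable_const.mul hgm))).aestronglyMeasurable
      (K * Real.exp 1) (ae_of_all _ fun x => ?_)
    rw [Real.norm_eq_abs, abs_mul, abs_of_pos (Real.exp_pos _)]
    refine mul_le_mul (hK x) (Real.exp_le_exp.2 ?_) (Real.exp_pos _).le ((abs_nonneg _).trans (hK x))
    calc t * g x ≤ |t * g x| := le_abs_self _
      _ = |t| * |g x| := abs_mul _ _
      _ ≤ |t| * K := mul_le_mul_of_nonneg_left (hK x) (abs_nonneg _)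
      _ ≤ 1 := ht
  -- `E[h e^{th}] − tσ² = E[h e^{th} − h − t h²]`
  have hI1 : Integrable (fun x => g x * Real.exp (t * g x) - g x) ν := hprod.sub hgi
  have hI2 : Integrable (fun x => t * g x ^ 2) ν := hg2.const_mul t
  have hsplit : (∫ x, g x * Real.exp (t * g x) ∂ν) - t * Var[g; ν]
      = ∫ x, (g x * Real.exp (t * g x) - g x - t * g x ^ 2) ∂ν := by
    rw [integral_sub hI1 hI2, integral_sub hprod hgi, h0, sub_zero, integral_const_mul, hvar]
  rw [hsplit]
  have hpt : ∀ x, |g x * Real.exp (t * g x) - g x - t * g x ^ 2| ≤ t ^ 2 * K ^ 3 := by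
    intro x
    have htx : |t * g x| ≤ 1 := by
      rw [abs_mul]; exact (mul_le_mul_of_nonneg_left (hK x) (abs_nonneg _)).trans ht
    have he := Real.abs_exp_sub_one_sub_id_le htx
    have e : g x * Real.exp (t * g x) - g x - t * g x ^ 2 = g x * (Real.exp (t * g x) - 1 - t * g x) := by
      ring
    rw [e, abs_mul]
    calc |g x| * |Real.exp (t * g x) - 1 - t * g x| ≤ K * (t * g x) ^ 2 :=
          mul_le_mul (hK x) he (abs_nonneg _) ((abs_nonneg _).trans (hK x))
      _ = K * t ^ 2 * |g x| ^ 2 := by rw [mul_pow, sq_abs]; ring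
      _ ≤ K * t ^ 2 * K ^ 2 := by
          refine mul_le_mul_of_nonneg_left (pow_le_pow_left₀ (abs_nonneg _) (hK x) 2) ?_
          exact mul_nonneg ((abs_nonneg _).trans (hK x)) (sq_nonneg _)
      _ = t ^ 2 * K ^ 3 := by ring
  calc |∫ x, (g x * Real.exp (t * g x) - g x - t * g x ^ 2) ∂ν|
      ≤ ∫ x, |g x * Real.exp (t * g x) - g x - t * g x ^ 2| ∂ν := by
        have h := norm_integral_le_integral_norm (μ := ν)
          (fun x => g x * Real.exp (t * g x) - g x - t * g x ^ 2)
        simp only [Real.norm_eq_abs] at h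
        exact h
    _ ≤ ∫ _x, t ^ 2 * K ^ 3 ∂ν :=
        integral_mono_of_nonneg (ae_of_all _ fun x => abs_nonneg _) (integrable_const _)
          (ae_of_all _ hpt)
    _ = t ^ 2 * K ^ 3 := by simp

/-- `1 ≤ M(t)` for a bounded centred statistic (Jensen, via `cgf ≥ 0`). [ours] -/
theorem one_le_mgf (hgm : Measurable g) {K : ℝ} (hK : ∀ x, |g x| ≤ K) (h0 : ∫ x, g x ∂ν = 0) (t : ℝ) :
    1 ≤ mgf g ν t := by
  have hgb : ∀ᵐ x ∂ν, g x ∈ Set.Icc (-K) K := ae_of_all _ fun x => abs_le.1 (hK x)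
  have hi : Integrable (fun x => Real.exp (t * g x)) ν := integrable_exp_mul_of_mem_Icc hgm.aemeasurable hgb
  have h := cgf_nonneg_of_centred hgm hK h0 t
  rw [← exp_cgf hi]
  exact Real.one_le_exp h

/-- **`|cgf′(t) − tσ²| ≤ 2t²K³`** for `|t|K ≤ 1/2`. [ours] -/
theorem abs_deriv_cgf_sub_le (hgm : Measurable g) {K : ℝ} (hK : ∀ x, |g x| ≤ K)
    (h0 : ∫ x, g x ∂ν = 0) {t : ℝ} (ht : |t| * K ≤ 1 / 2) :
    |deriv (cgf g ν) t - t * Var[g; ν]| ≤ 2 * t ^ 2 * K ^ 3 := by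
  have hgb : ∀ᵐ x ∂ν, g x ∈ Set.Icc (-K) K := ae_of_all _ fun x => abs_le.1 (hK x)
  have hga : AEMeasurable g ν := hgm.aemeasurable
  obtain ⟨y0, -⟩ := nonempty_of_measure_ne_zero (show ν Set.univ ≠ 0 by simp)
  have hK0 : 0 ≤ K := (abs_nonneg _).trans (hK y0)
  have hint : interior (integrableExpSet g ν) = Set.univ :=
    interior_integrableExpSet_eq_univ_of_mem_Icc hga hgb
  have hmem : t ∈ interior (integrableExpSet g ν) := by rw [hint]; exact Set.mem_univ _
  have ht1 : |t| * K ≤ 1 := ht.trans (by norm_num)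
  have hM1 : 1 ≤ mgf g ν t := one_le_mgf hgm hK h0 t
  have hMpos : 0 < mgf g ν t := lt_of_lt_of_le one_pos hM1
  have hM' := abs_deriv_mgf_sub_le hgm hK h0 ht1
  have hT := abs_mgf_sub_taylor_le ν hgm hK h0 ht1
  have hvarK : Var[g; ν] ≤ K ^ 2 := by
    have hv := variance_le_sq_of_bounded hgb hga
    calc Var[g; ν] ≤ ((K - -K) / 2) ^ 2 := hv
      _ = K ^ 2 := by ring
  have hv0 : 0 ≤ Var[g; ν] := variance_nonneg _ _
  rw [deriv_cgf hmem]
  rw [deriv_mgf hmem] at hM'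
  set A : ℝ := ∫ x, g x * Real.exp (t * g x) ∂ν with hA
  set M : ℝ := mgf g ν t with hM
  -- `A/M − tσ² = (A − tσ²)/M − tσ²(M − 1)/M`
  have e : A / M - t * Var[g; ν] = ((A - t * Var[g; ν]) - t * Var[g; ν] * (M - 1)) / M := by
    field_simp
    ring
  rw [e, abs_div, abs_of_pos hMpos, div_le_iff₀ hMpos]
  have hM1' : M - 1 ≤ t ^ 2 * Var[g; ν] / 2 + |t| ^ 3 * K ^ 3 := by
    have := (abs_le.1 hT).2; linarith
  have hM10 : 0 ≤ M - 1 := by linarith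
  calc |(A - t * Var[g; ν]) - t * Var[g; ν] * (M - 1)|
      ≤ |A - t * Var[g; ν]| + |t * Var[g; ν] * (M - 1)| := abs_sub _ _
    _ ≤ t ^ 2 * K ^ 3 + |t| * K ^ 2 * (t ^ 2 * K ^ 2 / 2 + |t| ^ 3 * K ^ 3) := by
        refine add_le_add hM' ?_
        rw [abs_mul, abs_mul, abs_of_nonneg hv0, abs_of_nonneg hM10]
        refine mul_le_mul (mul_le_mul_of_nonneg_left hvarK (abs_nonneg _)) ?_ hM10 (by positivity)
        calc M - 1 ≤ t ^ 2 * Var[g; ν] / 2 + |t| ^ 3 * K ^ 3 := hM1'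
          _ ≤ t ^ 2 * K ^ 2 / 2 + |t| ^ 3 * K ^ 3 := by
              have := mul_le_mul_of_nonneg_left hvarK (sq_nonneg t); linarith
    _ ≤ 2 * t ^ 2 * K ^ 3 * M := by
        -- with `s = |t|K ≤ 1/2`: `t²K³ + |t|K²(t²K²/2 + |t|³K³) = t²K³(1 + s/2 + s²) ≤ 2t²K³ ≤ 2t²K³·M`
        set s : ℝ := |t| * K with hs
        have hs0 : 0 ≤ s := mul_nonneg (abs_nonneg _) hK0
        have hs1 : s ≤ 1 / 2 := ht
        have ht2 : t ^ 2 = |t| ^ 2 := (sq_abs t).symm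
        have key : t ^ 2 * K ^ 3 + |t| * K ^ 2 * (t ^ 2 * K ^ 2 / 2 + |t| ^ 3 * K ^ 3)
            = t ^ 2 * K ^ 3 * (1 + s / 2 + s ^ 2) := by
          rw [hs, ht2]; ring
        rw [key]
        have h3 : 1 + s / 2 + s ^ 2 ≤ 2 := by nlinarith
        have h4 : 0 ≤ t ^ 2 * K ^ 3 := by positivity
        calc t ^ 2 * K ^ 3 * (1 + s / 2 + s ^ 2) ≤ t ^ 2 * K ^ 3 * 2 :=
              mul_le_mul_of_nonneg_left h3 h4
          _ = 2 * t ^ 2 * K ^ 3 * 1 := by ring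
          _ ≤ 2 * t ^ 2 * K ^ 3 * M := mul_le_mul_of_nonneg_left hM1 (by positivity)

/-- **`|t·cgf′(t) − cgf(t) − t²σ²/2| ≤ 4|t|³K³`** for `|t|K ≤ 1/2`: the forward Bregman term (the forward
loss per block) with an explicit cubic error. [ours] -/
theorem abs_fwdBregman_sub_le (hgm : Measurable g) {K : ℝ} (hK : ∀ x, |g x| ≤ K)
    (h0 : ∫ x, g x ∂ν = 0) {t : ℝ} (ht : |t| * K ≤ 1 / 2) :
    |t * deriv (cgf g ν) t - cgf g ν t - t ^ 2 * Var[g; ν] / 2| ≤ 4 * |t| ^ 3 * K ^ 3 := by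
  have h1 := abs_deriv_cgf_sub_le hgm hK h0 ht
  have h2 := abs_cgf_sub_le ν hgm hK h0 ht
  have e : t * deriv (cgf g ν) t - cgf g ν t - t ^ 2 * Var[g; ν] / 2
      = t * (deriv (cgf g ν) t - t * Var[g; ν]) - (cgf g ν t - t ^ 2 * Var[g; ν] / 2) := by ring
  rw [e]
  calc |t * (deriv (cgf g ν) t - t * Var[g; ν]) - (cgf g ν t - t ^ 2 * Var[g; ν] / 2)|
      ≤ |t * (deriv (cgf g ν) t - t * Var[g; ν])| + |cgf g ν t - t ^ 2 * Var[g; ν] / 2| := abs_sub _ _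
    _ ≤ |t| * (2 * t ^ 2 * K ^ 3) + 2 * |t| ^ 3 * K ^ 3 := by
        rw [abs_mul]; exact add_le_add (mul_le_mul_of_nonneg_left h1 (abs_nonneg _)) h2
    _ = 4 * |t| ^ 3 * K ^ 3 := by rw [← sq_abs t]; ring

/-- The `n`-block forward loss is quadratic in the coupling uniformly in the volume:
`|n(β cgf′(β) − cgf(β)) − nβ²σ²/2| ≤ 4n|β|³K³` (`|β|K ≤ 1/2`). [ours] -/
theorem abs_nat_mul_fwdBregman_sub_le (hgm : Measurable g) {K : ℝ} (hK : ∀ x, |g x| ≤ K)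
    (h0 : ∫ x, g x ∂ν = 0) {β : ℝ} (hβ : |β| * K ≤ 1 / 2) (n : ℕ) :
    |(n : ℝ) * (β * deriv (cgf g ν) β - cgf g ν β) - n * (β ^ 2 * Var[g; ν] / 2)|
      ≤ 4 * n * |β| ^ 3 * K ^ 3 := by
  rw [← mul_sub, abs_mul, Nat.abs_cast]
  calc (n : ℝ) * |β * deriv (cgf g ν) β - cgf g ν β - β ^ 2 * Var[g; ν] / 2|
      ≤ n * (4 * |β| ^ 3 * K ^ 3) :=
        mul_le_mul_of_nonneg_left (abs_fwdBregman_sub_le hgm hK h0 hβ) (Nat.cast_nonneg n)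
    _ = 4 * n * |β| ^ 3 * K ^ 3 := by ring

end ForwardRate

/-! ## Inversion of the forward loss -/

section ForwardInversion

variable {X : Type*} {mX : MeasurableSpace X} {ν : Measure X} [IsProbabilityMeasure ν] {g : X → ℝ}

/-- The forward Bregman term has derivative `t·cgf″(t)`. [ours] -/
theorem hasDerivAt_fwdBregman (hgm : Measurable g) {K : ℝ} (hK : ∀ x, |g x| ≤ K) (t : ℝ) :
    HasDerivAt (fun u => u * deriv (cgf g ν) u - cgf g ν u) (t * iteratedDeriv 2 (cgf g ν) t) t := by
  have hgb : ∀ᵐ x ∂ν, g x ∈ Set.Icc (-K) K := ae_of_all _ fun x => abs_le.1 (hK x)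
  have hint : interior (integrableExpSet g ν) = Set.univ :=
    interior_integrableExpSet_eq_univ_of_mem_Icc hgm.aemeasurable hgb
  have han : AnalyticOnNhd ℝ (cgf g ν) Set.univ := by rw [← hint]; exact analyticOnNhd_cgf
  have hd1 : HasDerivAt (cgf g ν) (deriv (cgf g ν) t) t :=
    (han t (Set.mem_univ t)).differentiableAt.hasDerivAt
  have hd2 : HasDerivAt (deriv (cgf g ν)) (iteratedDeriv 2 (cgf g ν) t) t := by
    have h := (han.deriv t (Set.mem_univ t)).differentiableAt.hasDerivAt
    rw [iteratedDeriv_succ, iteratedDeriv_one]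
    exact h
  have h := ((hasDerivAt_id' t).mul hd2).sub hd1
  exact h.congr_deriv (by ring)

/-- **The forward Bregman term is non-decreasing on `[0, ∞)`** (`cgf″ = Var` under the tilt `≥ 0`). [ours] -/
theorem fwdBregman_monotoneOn (hgm : Measurable g) {K : ℝ} (hK : ∀ x, |g x| ≤ K) :
    MonotoneOn (fun u => u * deriv (cgf g ν) u - cgf g ν u) (Set.Ici 0) := by
  have hgb : ∀ᵐ x ∂ν, g x ∈ Set.Icc (-K) K := ae_of_all _ fun x => abs_le.1 (hK x)
  have hint : interior (integrableExpSet g ν) = Set.univ :=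
    interior_integrableExpSet_eq_univ_of_mem_Icc hgm.aemeasurable hgb
  have hd := fun t => hasDerivAt_fwdBregman (ν := ν) hgm hK t
  refine monotoneOn_of_deriv_nonneg (convex_Ici 0) (fun t _ => (hd t).continuousAt.continuousWithinAt)
    (fun t _ => (hd t).differentiableAt.differentiableWithinAt) fun t ht => ?_
  rw [(hd t).deriv]
  rw [interior_Ici] at ht
  have h2 : 0 ≤ iteratedDeriv 2 (cgf g ν) t := by
    rw [← variance_tilted_mul (by rw [hint]; exact Set.mem_univ t)]
    exact variance_nonneg _ _
  exact mul_nonneg (le_of_lt ht) h2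

/-- The forward Bregman term is non-negative on `[0, ∞)`. [ours] -/
theorem fwdBregman_nonneg (hgm : Measurable g) {K : ℝ} (hK : ∀ x, |g x| ≤ K) {t : ℝ} (ht : 0 ≤ t) :
    0 ≤ t * deriv (cgf g ν) t - cgf g ν t := by
  have h := fwdBregman_monotoneOn (ν := ν) hgm hK (Set.mem_Ici.2 le_rfl) (Set.mem_Ici.2 ht) ht
  simpa [cgf_zero] using h

/-- **Inversion of the forward loss, I**: `β_n ≥ 0`, `σ² ≠ 0`, `n·(β_n cgf′(β_n) − cgf(β_n)) → D` ⇒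
`β_n → 0`. [ours] -/
theorem tendsto_zero_of_nat_mul_fwdBregman_tendsto (hgm : Measurable g) {K : ℝ} (hK : ∀ x, |g x| ≤ K)
    (h0 : ∫ x, g x ∂ν = 0) (hσ : Var[g; ν] ≠ 0) {β : ℕ → ℝ} (hβ0 : ∀ n, 0 ≤ β n) {D : ℝ}
    (hD : Tendsto (fun n : ℕ => (n : ℝ) * (β n * deriv (cgf g ν) (β n) - cgf g ν (β n))) atTop (𝓝 D)) :
    Tendsto β atTop (𝓝 0) := by
  have hv : 0 < Var[g; ν] := lt_of_le_of_ne (variance_nonneg _ _) (Ne.symm hσ)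
  set K' : ℝ := |K| + 1 with hK'
  have hK'0 : 0 < K' := by rw [hK']; positivity
  have hK'' : ∀ x, |g x| ≤ K' := fun x => (hK x).trans (by rw [hK']; linarith [le_abs_self K])
  rw [tendsto_order]
  refine ⟨fun a ha => Filter.Eventually.of_forall fun n => ha.trans_le (hβ0 n), fun δ hδ => ?_⟩
  set δ' : ℝ := min δ (min (1 / (2 * K')) (Var[g; ν] / (16 * K' ^ 3))) with hδ'
  have hδ'0 : 0 < δ' := by rw [hδ']; positivity
  have hδ'δ : δ' ≤ δ := min_le_left _ _
  have hδ'K : |δ'| * K' ≤ 1 / 2 := by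
    rw [abs_of_pos hδ'0]
    have : δ' ≤ 1 / (2 * K') := (min_le_right _ _).trans (min_le_left _ _)
    rw [le_div_iff₀ (by positivity)] at this
    linarith
  have hδ'σ : 4 * δ' * K' ^ 3 ≤ Var[g; ν] / 4 := by
    have : δ' ≤ Var[g; ν] / (16 * K' ^ 3) := (min_le_right _ _).trans (min_le_right _ _)
    rw [le_div_iff₀ (by positivity)] at this
    linarith
  have hrate := abs_fwdBregman_sub_le hgm hK'' h0 hδ'K
  rw [abs_of_pos hδ'0] at hrate
  have hlow1 : δ' ^ 2 * Var[g; ν] / 4 ≤ δ' * deriv (cgf g ν) δ' - cgf g ν δ' := by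
    have hl := (abs_le.1 hrate).1
    have e2 : 4 * δ' ^ 3 * K' ^ 3 ≤ δ' ^ 2 * (Var[g; ν] / 4) := by
      have := mul_le_mul_of_nonneg_left hδ'σ (sq_nonneg δ')
      nlinarith
    nlinarith
  have h2 : ∀ᶠ n : ℕ in atTop, (n : ℝ) * (β n * deriv (cgf g ν) (β n) - cgf g ν (β n)) < D + 1 :=
    (tendsto_order.1 hD).2 _ (lt_add_one D)
  have h3 : ∀ᶠ n : ℕ in atTop, D + 1 < (n : ℝ) * (δ' ^ 2 * Var[g; ν] / 4) :=
    (tendsto_natCast_atTop_atTop.atTop_mul_const (by positivity)).eventually_gt_atTop (D + 1)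
  filter_upwards [h2, h3] with n hn2 hn3
  by_contra hcon
  push Not at hcon
  have hmono := fwdBregman_monotoneOn (ν := ν) hgm hK (Set.mem_Ici.2 hδ'0.le) (Set.mem_Ici.2 (hβ0 n))
    (hδ'δ.trans hcon)
  have : (n : ℝ) * (δ' ^ 2 * Var[g; ν] / 4) ≤ (n : ℝ) * (β n * deriv (cgf g ν) (β n) - cgf g ν (β n)) :=
    mul_le_mul_of_nonneg_left (hlow1.trans hmono) (Nat.cast_nonneg n)
  linarith

/-- **Inversion of the forward loss, II**: … ⇒ `β_n·√n → √(2D/σ²)`. [ours] -/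
theorem sqrt_mul_tendsto_of_nat_mul_fwdBregman_tendsto (hgm : Measurable g) {K : ℝ} (hK : ∀ x, |g x| ≤ K)
    (h0 : ∫ x, g x ∂ν = 0) (hσ : Var[g; ν] ≠ 0) {β : ℕ → ℝ} (hβ0 : ∀ n, 0 ≤ β n) {D : ℝ}
    (hD : Tendsto (fun n : ℕ => (n : ℝ) * (β n * deriv (cgf g ν) (β n) - cgf g ν (β n))) atTop (𝓝 D)) :
    Tendsto (fun n : ℕ => β n * Real.sqrt n) atTop (𝓝 (Real.sqrt (2 * D / Var[g; ν]))) := by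
  have hv : 0 < Var[g; ν] := lt_of_le_of_ne (variance_nonneg _ _) (Ne.symm hσ)
  set K' : ℝ := |K| + 1 with hK'
  have hK'0 : 0 < K' := by rw [hK']; positivity
  have hK'' : ∀ x, |g x| ≤ K' := fun x => (hK x).trans (by rw [hK']; linarith [le_abs_self K])
  have hβlim := tendsto_zero_of_nat_mul_fwdBregman_tendsto hgm hK h0 hσ hβ0 hD
  classical
  set F : ℕ → ℝ := fun n => β n * deriv (cgf g ν) (β n) - cgf g ν (β n) with hF
  set e : ℕ → ℝ := fun n => if β n = 0 then 0 else (F n - β n ^ 2 * Var[g; ν] / 2) / β n ^ 2 with he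
  have hid : ∀ n : ℕ, (n : ℝ) * F n = (n : ℝ) * β n ^ 2 * (Var[g; ν] / 2 + e n) := by
    intro n
    by_cases hb : β n = 0
    · simp [he, hF, hb, cgf_zero]
    · simp only [he, hb, ↓reduceIte]
      field_simp
      ring
  have hebound : ∀ᶠ n : ℕ in atTop, |e n| ≤ 4 * β n * K' ^ 3 := by
    have hsmall : ∀ᶠ n : ℕ in atTop, β n < 1 / (2 * K') := (tendsto_order.1 hβlim).2 _ (by positivity)
    filter_upwards [hsmall] with n hn
    by_cases hb : β n = 0
    · simp [he, hb]
    · have hbpos : 0 < β n := lt_of_le_of_ne (hβ0 n) (Ne.symm hb)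
      have hu : |β n| * K' ≤ 1 / 2 := by
        rw [abs_of_pos hbpos]; rw [lt_div_iff₀ (by positivity)] at hn; linarith
      have hrate := abs_fwdBregman_sub_le hgm hK'' h0 hu
      rw [abs_of_pos hbpos] at hrate
      simp only [he, hb, ↓reduceIte]
      rw [abs_div, abs_of_pos (by positivity : (0 : ℝ) < β n ^ 2), div_le_iff₀ (by positivity)]
      calc |F n - β n ^ 2 * Var[g; ν] / 2| ≤ 4 * β n ^ 3 * K' ^ 3 := hrate
        _ = 4 * β n * K' ^ 3 * β n ^ 2 := by ring
  have he0 : Tendsto e atTop (𝓝 0) := by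
    have hb2 : Tendsto (fun n => 4 * β n * K' ^ 3) atTop (𝓝 0) := by
      have := (hβlim.const_mul 4).mul_const (K' ^ 3)
      simpa using this
    exact squeeze_zero_norm' (by filter_upwards [hebound] with n hn; simpa [Real.norm_eq_abs] using hn) hb2
  have hw : Tendsto (fun n : ℕ => Var[g; ν] / 2 + e n) atTop (𝓝 (Var[g; ν] / 2)) := by
    have := he0.const_add (Var[g; ν] / 2)
    simpa using this
  have hsq : Tendsto (fun n : ℕ => (n : ℝ) * β n ^ 2) atTop (𝓝 (D / (Var[g; ν] / 2))) := by
    have hdiv := hD.div hw (by positivity)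
    refine hdiv.congr' ?_
    have hne : ∀ᶠ n : ℕ in atTop, Var[g; ν] / 2 + e n ≠ 0 := hw.eventually_ne (by positivity)
    filter_upwards [hne] with n hne'
    rw [Pi.div_apply]
    show (n : ℝ) * F n / (Var[g; ν] / 2 + e n) = n * β n ^ 2
    rw [hid n, mul_div_assoc, div_self hne', mul_one]
  have e2 : D / (Var[g; ν] / 2) = 2 * D / Var[g; ν] := by field_simp
  rw [e2] at hsq
  refine hsq.sqrt.congr fun n => ?_
  rw [Real.sqrt_mul (Nat.cast_nonneg n), Real.sqrt_sq (hβ0 n), mul_comm]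

end ForwardInversion

end Summit.Ventures.LatticeQCDFlow.Theory2

end
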